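import Summits.ABC.IUTFork.Joshi.ATS4DescentSpineGenuineResidualUnsatDegOne
import HarnessLib

/-!
# [J-IV] (arXiv:2403.10430v2) §6.10–§7.1, E5 descent spine: the `d = 1` narrowing of the hypothesis of `abc_of_genuineResidual_reading3`
# is FALSE too (R-J row Y-21 PARENT, small print (r2), second corollary)

Proof-only companion (0 defs) of the abc-iut cell, sub-cell R-J «JOSHI Y-DISCHARGE CENSUS» (rung LADDER-ABC:A2.RESCUE.J), row Y-21 PARENT,
seat abc-iut-E-t35 (gen 10), E-plan GO (α) 02:11:35Z. Sequel of `ATS4DescentSpineGenuineResidualUnsatDegOne.lean`: there the `d = 1`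
narrowing `H₁` of the hypothesis of E-t33's `abc_of_genuineResidualSupport` (p464392 §4) was refuted in kernel
(`not_genuineResidualSupport_antecedent_degOne`, witness `λ_k = 1/2 + 2/7^k`, `p₀ = 7`, every prime `ℓ ≥ 11`). E-t33's §5 theorem
`abc_of_genuineResidual_reading3` has the SAME binder with `V^dst_ℚ` FIXED to the reading-(3) set `primeFactors(30ℓ) ∪ p(Supp 𝔮_{F_tpd}) ∪
primeFactors(disc F_tpd)` of Lemma 6.7.1; p464392 derives it from the §4 theorem by showing that this set is an admissible `V^dst_ℚ` (three-way
by E-t24's `GenuineVdst.prime_of_mem_reading3` / `threeWay_of_mem_reading3`, p460545; «ramified in `K` ⟹ in the set» by this lineage's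
`GenuineVdst.residueChar_mem_of_ramified`, p456387; «`Supp(𝔮_F)` over `Supp(𝔮_{F_tpd})`» by `TateDivisorDatum.mem_ofNFPointOver_V_iff`). The same
passage, read contrapositively AT `d = 1` (this is the `d = 1` twin of this seat's gen-9 `not_genuineResidual_reading3_antecedent`, p480909):

* **`not_genuineResidual_reading3_antecedent_degOne`** — the `d = 1` narrowing `H₁'` of the hypothesis of `abc_of_genuineResidual_reading3`
  (that hypothesis with `d` FIXED TO `1`, VERBATIM; `H' → H₁'` is `fun h => h 1 one_pos`, reader's check at the end) is FALSE: a supplier meeting it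
  would meet `H₁` (`not_genuineResidualSupport_antecedent_degOne`). So BOTH genuine-component forms of the E5 residual stay VACUOUS implications
  even when their binders are narrowed to `ℚ`-points — the census word's small print (r2) is covered in kernel for both.

SOURCE locators: [J-IV] Lemma 6.7.1 p.61 l.20–30, §6.6 p.60 l.56–62, Prop. 6.10.9 p.69 l.1–28, (6.11.1) p.69 l.73–p.70 l.3 (render
`HOME/lit/renders/Joshi-arxiv-2403.10430/`). FRAMING (binding): a located COUNTERMODEL to the E5 residual AS PRINTED with (6.11.1)'s `Σ|·|`
convention at OUR typed carriers, at `d = 1` — not to any author's theorem; NO side taken on [IUTchIII] Cor. 3.12 / [IUTchIV] Thm. 1.10, on Joshi's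
claims or on Mochizuki's report; NOT an abc claim; typed ≠ proved ≠ endorsed. Theorems only; standard axioms. [claim: Joshi2024ATS4, status: disputed].
-/

noncomputable section

namespace Summit.ABC.IUTFork.Joshi.ATS4

open NumberField IsDedekindDomain Finset
open Literature.IUT.LogVolume Literature.IUT.LogVolume.Cor22
open Literature.NumberTheory.DiophantineGeometry Literature.NumberTheory.DiophantineGeometry.GenEll
open Literature.NumberTheory.EllipticCurves
open scoped Classical

/-- **THE `d = 1` NARROWING OF THE HYPOTHESIS OF `abc_of_genuineResidual_reading3` (p464392 §5) IS FALSE** — the statement below is that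
hypothesis with `d` FIXED TO `1`, VERBATIM, negated. A supplier meeting it meets the `d = 1` narrowing `H₁` of the hypothesis of
`abc_of_genuineResidualSupport` with `V^dst_ℚ :=` the reading-(3) set (admissible: three-way by `GenuineVdst.prime_of_mem_reading3` /
`threeWay_of_mem_reading3`, ramified primes of `K` inside it by `GenuineVdst.residueChar_mem_of_ramified`, residue characteristics of `Supp(𝔮_F)`
inside it by `TateDivisorDatum.mem_ofNFPointOver_V_iff` — the passage of p464392 §5 / p480909, reused verbatim), which
`not_genuineResidualSupport_antecedent_degOne` refutes. LOCATES; no side taken on [IUTchIII] Cor. 3.12 / [IUTchIV] Thm. 1.10 or on any author;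
NOT an abc claim. [claim: Joshi2024ATS4, status: disputed] -/
theorem not_genuineResidual_reading3_antecedent_degOne :
    ¬ (∀ P ∈ UPle 1, ∀ (ℓ : ℕ) (hℓ : ℓ.Prime) (h5 : 5 ≤ ℓ), IsLem587Prime 1 P ℓ → ITDConditions P ℓ →
      AdmitsCore P → Real.log (4 * (2 ^ 12 * 3 ^ 3 * 5 * ((1 : ℕ) : ℝ)) * ℓ) ≤ 4 / 3 * ℓ →
        ∃ (F : Type) (_ : Field F) (_ : NumberField F) (_ : Algebra P.F F)
          (K : Type) (_ : Field K) (_ : NumberField K) (_ : Algebra F K) (_ : Algebra P.F K) (_ : IsScalarTower P.F F K)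
          (_ : IsGalois F K) (ψ : K →ₐ[F] AlgebraicClosure F) (hU : P.InU) (_ : IsThetaField P F)
          (_ : letI := thetaCurve_isElliptic hU F
            ((thetaCurve P F).galoisRepTorsion (ℓ : ℤ)).ker ≤ ψ.fieldRange.fixingSubgroup)
          (_ : 0 < (TateDivisorDatum.ofNFPointOver P {2, ℓ} F).logq)
          (Lmod : Type) (_ : Field Lmod) (_ : NumberField Lmod) (_ : Cor22.dmod P ≤ dMod Lmod) (_ : dMod Lmod ≤ 1)
          (DK : Finset (HeightOneSpectrum (𝓞 K))) (_ : ∀ u, differentDivisor K (Sum.inr u) ≠ 0 → u ∈ DK)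
          (vol : ℕ → ℝ) (volArch : ℝ),
          (∀ p ∈ (2 * 3 * 5 * ℓ).primeFactors ∪ (TateDivisorDatum.ofNFPoint P {2, ℓ}).V.image (residueChar P.F) ∪
              (discr P.F).natAbs.primeFactors,
            -(1 / (((ℓ : ℝ) - 1) / 2)) * |vol p| ≤ ((ℓ : ℝ) + 1) / 4 *
            ((1 + 4 / (ℓ : ℝ)) *
                ((Module.finrank ℚ K : ℝ)⁻¹ *
                  ∑ u ∈ DK with residueChar K u = p, differentDivisor K (Sum.inr u) * logNorm K u)
              - 1 / 6 *
                ((Module.finrank ℚ F : ℝ)⁻¹ *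
                  ∑ w ∈ (TateDivisorDatum.ofNFPointOver P {2, ℓ} F).V with residueChar F w = p,
                    (TateDivisorDatum.ofNFPointOver P {2, ℓ} F).tateDivisor (Sum.inr w) * logNorm F w)
              + 4 / (ℓ : ℝ) * Real.log p
              + 20 / 3 * ((2 ^ 12 * 3 ^ 3 * 5 * eMod Lmod : ℕ) : ℝ) *
                (if p ≤ 2 ^ 12 * 3 ^ 3 * 5 * eMod Lmod * ℓ then Real.log p / p else 0))) ∧
          -(1 / (2 * (ℓ : ℝ)) * (TateDivisorDatum.ofNFPointOver P {2, ℓ} F).logq) ≤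
            -(1 / (((ℓ : ℝ) - 1) / 2)) *
              (∑ p ∈ (2 * 3 * 5 * ℓ).primeFactors ∪ (TateDivisorDatum.ofNFPoint P {2, ℓ}).V.image (residueChar P.F) ∪
                  (discr P.F).natAbs.primeFactors, |vol p| + |volArch|)) := by
  intro h
  refine not_genuineResidualSupport_antecedent_degOne fun P hP ℓ hℓ h5 hℓP hITD hcore hroom => ?_
  obtain ⟨F, _, _, _, K, _, _, _, _, _, _, ψ, hU, hF, hK, hq, Lmod, _, _, hmod, hdmod, DK, hDK, vol, volArch, hStepV, hLower⟩ :=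
    h P hP ℓ hℓ h5 hℓP hITD hcore hroom
  -- the reading-(3) set is an admissible `V^dst_ℚ` (p464392 §5 / p480909, verbatim)
  refine ⟨F, inferInstance, inferInstance, inferInstance, K, inferInstance, inferInstance, inferInstance, inferInstance,
    inferInstance, inferInstance, ψ, hU, hF, hK, hq, Lmod, inferInstance, inferInstance, hmod, hdmod, _,
    fun q hq' => ⟨GenuineVdst.prime_of_mem_reading3 P ℓ hq', GenuineVdst.threeWay_of_mem_reading3 P ℓ K hq'⟩,
    fun u hu => GenuineVdst.residueChar_mem_of_ramified ψ hU hF hℓ hK (GenuineVdst.hsupp_ofNFPoint_pair hℓ) u hu,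
    fun w hw => ?_, DK, hDK, vol, volArch, hStepV, hLower⟩
  refine Finset.mem_union_left _ (Finset.mem_union_right _ (Finset.mem_image.mpr
    ⟨finBelow P.F F w, (TateDivisorDatum.mem_ofNFPointOver_V_iff (P := P) (S := {2, ℓ}) F w).1 hw, ?_⟩))
  exact residueChar_finBelow (F := P.F) w

/-! ## Reader's check: `H₁'` IS the `d = 1` instance of the hypothesis `h` of `abc_of_genuineResidual_reading3`; hence its `¬H'` again (cf. p480909) -/

/-- The hypothesis `h` below is typed BY NAME by p464392's `abc_of_genuineResidual_reading3` (first line of the body), and its `d = 1` instance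
`h 1 one_pos` is LITERALLY the statement negated by `not_genuineResidual_reading3_antecedent_degOne`; so `¬H'` follows — a second, `d = 1` proof of
this seat's gen-9 `not_genuineResidual_reading3_antecedent` (p480909). [claim: Joshi2024ATS4, status: disputed] -/
example : ¬ (∀ (d : ℕ), 0 < d → ∀ P ∈ UPle d, ∀ (ℓ : ℕ) (hℓ : ℓ.Prime) (h5 : 5 ≤ ℓ), IsLem587Prime d P ℓ → ITDConditions P ℓ →
      AdmitsCore P → Real.log (4 * (2 ^ 12 * 3 ^ 3 * 5 * (d : ℝ)) * ℓ) ≤ 4 / 3 * ℓ →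
        ∃ (F : Type) (_ : Field F) (_ : NumberField F) (_ : Algebra P.F F)
          (K : Type) (_ : Field K) (_ : NumberField K) (_ : Algebra F K) (_ : Algebra P.F K) (_ : IsScalarTower P.F F K)
          (_ : IsGalois F K) (ψ : K →ₐ[F] AlgebraicClosure F) (hU : P.InU) (_ : IsThetaField P F)
          (_ : letI := thetaCurve_isElliptic hU F
            ((thetaCurve P F).galoisRepTorsion (ℓ : ℤ)).ker ≤ ψ.fieldRange.fixingSubgroup)
          (_ : 0 < (TateDivisorDatum.ofNFPointOver P {2, ℓ} F).logq)
          (Lmod : Type) (_ : Field Lmod) (_ : NumberField Lmod) (_ : Cor22.dmod P ≤ dMod Lmod) (_ : dMod Lmod ≤ d)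
          (DK : Finset (HeightOneSpectrum (𝓞 K))) (_ : ∀ u, differentDivisor K (Sum.inr u) ≠ 0 → u ∈ DK)
          (vol : ℕ → ℝ) (volArch : ℝ),
          (∀ p ∈ (2 * 3 * 5 * ℓ).primeFactors ∪ (TateDivisorDatum.ofNFPoint P {2, ℓ}).V.image (residueChar P.F) ∪
              (discr P.F).natAbs.primeFactors,
            -(1 / (((ℓ : ℝ) - 1) / 2)) * |vol p| ≤ ((ℓ : ℝ) + 1) / 4 *
            ((1 + 4 / (ℓ : ℝ)) *
                ((Module.finrank ℚ K : ℝ)⁻¹ *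
                  ∑ u ∈ DK with residueChar K u = p, differentDivisor K (Sum.inr u) * logNorm K u)
              - 1 / 6 *
                ((Module.finrank ℚ F : ℝ)⁻¹ *
                  ∑ w ∈ (TateDivisorDatum.ofNFPointOver P {2, ℓ} F).V with residueChar F w = p,
                    (TateDivisorDatum.ofNFPointOver P {2, ℓ} F).tateDivisor (Sum.inr w) * logNorm F w)
              + 4 / (ℓ : ℝ) * Real.log p
              + 20 / 3 * ((2 ^ 12 * 3 ^ 3 * 5 * eMod Lmod : ℕ) : ℝ) *
                (if p ≤ 2 ^ 12 * 3 ^ 3 * 5 * eMod Lmod * ℓ then Real.log p / p else 0))) ∧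
          -(1 / (2 * (ℓ : ℝ)) * (TateDivisorDatum.ofNFPointOver P {2, ℓ} F).logq) ≤
            -(1 / (((ℓ : ℝ) - 1) / 2)) *
              (∑ p ∈ (2 * 3 * 5 * ℓ).primeFactors ∪ (TateDivisorDatum.ofNFPoint P {2, ℓ}).V.image (residueChar P.F) ∪
                  (discr P.F).natAbs.primeFactors, |vol p| + |volArch|)) := fun h =>
  -- BY NAME: `h` is literally the hypothesis of p464392's `abc_of_genuineResidual_reading3`
  have _hvacuous : ABC := abc_of_genuineResidual_reading3 h
  not_genuineResidual_reading3_antecedent_degOne (h 1 one_pos)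

end Summit.ABC.IUTFork.Joshi.ATS4

end
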